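import Summits.QuantumFields.YangMills.Theorems.UnitScaleTiltProp8FlatPortCurlCurlSupRowL0
import Summits.QuantumFields.YangMills.Theorems.UnitScaleTiltProp8FlatCubeSequenceAdm
import Summits.QuantumFields.YangMills.Theorems.UnitScaleTiltProp8FlatPortCurlCurlPairingL0
import Summits.QuantumFields.YangMills.Theorems.UnitScaleTiltProp8FlatHCurlCurlMatrix
import HarnessLib

/-!
# Route `UnitScaleTilt`, crux K1 child «MinimiserStabilityRegPr» (stmt-QuantumFields-19200), stub H `stub_halvingStep`, the (165)-A₁ row's dressing letter `C_E`:
# **(X1) AT THE ALIGNED CUBE SEQUENCE (144)** — the `∂^{η*}∂^η`-sup row of the canonical `flatH` of the P5 datum `cubeSeqMT3 F n K x₀ ρ S M` (big blocks `M = L·M_h`,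
# `M_h = L^{a′}`, separation `R·M ≤ S`), constants from `L` alone — `FlatPortCurlCurlSupRowL0.curlCurlSupRow_of_adm22` ∘ `FlatCubeSequenceAdm.adm22_cubeSeqMT3`
# (the plug the M2 knit's `hX1` reads at T3 through `FlatHCurlCurlMatrix.matrix_curlCurlSupRow`)

Cell `ym3-torus` (HUMAN RULING D-0037, YM ladder rung R3), width seat `ym-ust-19936-w3` gen 4 (★★OWNER ym3-torus-plan g26 RULING g26-№7 (3); ★w6-19200 g0 07:03:57Z «for your NEXT
(`hX1_cubeSeq`∕`hCH_cubeSeq` at `D := cubeSeqMT3 …`): … `FlatCubeSequenceAdm` … show the exact plug»).  `--supports stmt-QuantumFields-19200 --as helper`; count-neutral; def-free.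
Serves item 19936 `HistoryTailL` only through (T).

WHAT IS PROVED (sorry-free; axioms standard; no definition).  ★★ **`curlCurlSupRow_cubeSeqMT3 (ℓ) (hL) (hℓ : 4 ≤ ℓ)`**: there are `M_h⁰, R₀ : ℕ` and `C_X ≥ 0` (functions of `L = ℓ+1`
only) such that for every member `F = ⟨ℓ+1, hL, m, hm⟩`, heights `1 ≤ K − n`, `K − n + 1 ≤ m + K`, big-block data `M_h = L^{a′} ≥ M_h⁰`, `R ≥ R₀`, `a′ + 3 ≤ m + n`, every centre
`x₀`, radii `ρ`, `S` with `R·(L·M_h) ≤ S`, every P2 weight family `w` of `cubeSeqMT3 F n K x₀ ρ S (L·M_h)`, every index datum `X` with `|X c| ≤ t` (`t ≥ 0`) and every fine bond `b`: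
`w 3 b·|(dcsE η⁻¹ (dcE η⁻¹ (toLp 2 (flatH F n K (cubeSeqMT3 …) X)))) b| ≤ C_X·t`.  The binder list is `quarter164_of_flatOpsAdmAtMS`'s geometry (`R·M ≤ S`, `M` a power of `L`)
in the port's currency (`M = L·M_h`); (X2-CH) and the M₂ readings at the same datum follow by `FlatPortCurlCurlPairingL0.curlCurlPairing_of_adm22` and
`FlatHCurlCurlMatrix.matrix_curlCurlSupRow`∕`matrix_curlCurlPairing` (appended when their proposals land).
HONEST SCOPE: a one-step instantiation; inherits `L ≥ 5` and `a′ + 3 ≤ m + n` (≥ `5L` big blocks per direction) from the port; NOT a claim about the mass gap.  YM₃ on the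
three-torus is rung R3 of the programme, not the Clay problem.

References: T. Bałaban, CMP **102** (1985) 277–309 [Balaban1985Variational] (88) p.291, (144) p.300, (161)–(163) p.303; CMP **96** (1984) 223–250 [Balaban1984PropagatorsII]
(2.1)–(2.2) p.224, Lemma 2.1 (2.61) p.234, Prop. 2.7 (2.149) p.249.
-/

set_option autoImplicit false

noncomputable section

namespace Summit.QuantumFields.YangMills.Theorems.FlatPortCurlCurlCubeSeq

open Literature.MathematicalPhysics.QuantumFieldTheory.Balaban1983to89
open B6GlobalChartV1 (PV)
open B6SectAOperatorsV1 (BondIdx dcE dcsE)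
open T3ContinuumYM3Torus (T3Family)
open FlatCubeOpsText (IsLevWeight)
open FlatOpsLettersAssembly (flatH)
open FlatCubeSequenceAligned (cubeSeqMT3 cubeSeqMT3_k)
open FlatCubeSequenceAdm (adm22_cubeSeqMT3)
open FlatPortCurlCurlSupRowL0 (curlCurlSupRow_of_adm22)

/-- `1 ≤ 3` (named once). [folklore] -/
private theorem hd3 : 1 ≤ 2 + 1 := by norm_num

/-- ★★ **(X1) AT THE ALIGNED CUBE SEQUENCE**: the `∂^{η*}∂^η`-sup row of `flatH F n K (cubeSeqMT3 F n K x₀ ρ S (L·M_h))` at plain-sup data, with constants from `L` alone,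
for every odd `L = ℓ + 1 ≥ 5`, big-block data `M_h = L^{a′} ≥ M_h⁰`, `R ≥ R₀`, `a′ + 3 ≤ m + n`, and separation `R·(L·M_h) ≤ S`.
[cite: Balaban1985Variational, (88) p.291, (144) p.300, (161)-(163) p.303; Balaban1984PropagatorsII, (2.1)-(2.2) p.224, Prop. 2.7 (2.149) p.249, Lemma 2.1 (2.61) p.234] -/
theorem curlCurlSupRow_cubeSeqMT3 (ℓ : ℕ) (hL : Odd (ℓ + 1) ∧ 1 < ℓ + 1) (hℓ : 4 ≤ ℓ) :
    ∃ (Mh₀ R₀ : ℕ) (CX : ℝ), 0 ≤ CX ∧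
    ∀ (m : ℕ) (hm : 1 ≤ m) (n K : ℕ) (_ : 1 ≤ K - n) (_ : K - n + 1 ≤ m + K) {Mh R a' : ℕ} (_ : Mh = (ℓ + 1) ^ a') (_ : Mh₀ ≤ Mh) (_ : R₀ ≤ R)
      (_ : a' + 3 ≤ m + n) (x₀ : Site (((⟨ℓ + 1, hL, m, hm⟩ : T3Family)).P K) 0) (ρ S : ℕ) (hM : 1 ≤ (ℓ + 1) * Mh) (_ : R * ((ℓ + 1) * Mh) ≤ S)
      (w : ℕ → PBond (PV 2 ℓ m K hd3 hL) 0 → ℝ)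
      (_ : IsLevWeight (⟨ℓ + 1, hL, m, hm⟩ : T3Family) n K (cubeSeqMT3 (⟨ℓ + 1, hL, m, hm⟩ : T3Family) n K x₀ ρ S ((ℓ + 1) * Mh) hM) w)
      (X : BondIdx (cubeSeqMT3 (⟨ℓ + 1, hL, m, hm⟩ : T3Family) n K x₀ ρ S ((ℓ + 1) * Mh) hM) → ℝ) (t : ℝ) (_ : 0 ≤ t) (_ : ∀ c, |X c| ≤ t)
      (b : PBond (PV 2 ℓ m K hd3 hL) 0),
        w 3 b * |(dcsE ((((ℓ + 1 : ℕ) : ℝ)) ^ (K - n)) (dcE ((((ℓ + 1 : ℕ) : ℝ)) ^ (K - n))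
          (WithLp.toLp 2 (flatH (⟨ℓ + 1, hL, m, hm⟩ : T3Family) n K (cubeSeqMT3 (⟨ℓ + 1, hL, m, hm⟩ : T3Family) n K x₀ ρ S ((ℓ + 1) * Mh) hM) X)))) b| ≤ CX * t := by
  obtain ⟨Mh₀, R₀, CX, hCX, hmain⟩ := curlCurlSupRow_of_adm22 ℓ hL hℓ
  refine ⟨Mh₀, R₀, CX, hCX, ?_⟩
  intro m hm n K hk1 hk' Mh R a' hMha hMh hR hsize x₀ ρ S hM hRS w hw X t ht hX b
  exact hmain m hm n K hk1 hk' hMha hMh hR hsize (cubeSeqMT3 (⟨ℓ + 1, hL, m, hm⟩ : T3Family) n K x₀ ρ S ((ℓ + 1) * Mh) hM)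
    (cubeSeqMT3_k (⟨ℓ + 1, hL, m, hm⟩ : T3Family) n K x₀ ρ S ((ℓ + 1) * Mh) hM)
    (adm22_cubeSeqMT3 (⟨ℓ + 1, hL, m, hm⟩ : T3Family) n K x₀ ρ hM hRS) w hw X t ht hX b


/-! ## §2 (X2-CH) at the aligned cube sequence; §3 the M₂ readings (`hX1`∕`hCH` of the M2 knit) at the same datum
(appended once ✓p609998 `…FlatPortCurlCurlPairingL0` and ✓p610606 `…FlatHCurlCurlMatrix` landed; section-local `open`s) -/

section PairingAndMatrix

open scoped Matrix.Norms.L2Operator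

open FlatHCurlCurlPairing (levWeight_pos)
open FlatHCurlCurlMatrix (matrix_curlCurlSupRow matrix_curlCurlPairing)

/-- ★★ **(X2-CH) AT THE ALIGNED CUBE SEQUENCE**: the `∂^{η*}∂^η`-pairing letter of `flatH F n K (cubeSeqMT3 …)` against any field `Z` with gradient letter `≤ s`,
`|Σ_b (∂^{η*}∂^η flatH X)(b)·Z(b)| ≤ C_P·(L^{K−n})³·s·Σ_c |X c|`, constants from `L` alone (`curlCurlPairing_of_adm22` ∘ `adm22_cubeSeqMT3`).
[cite: Balaban1985Variational, (88) p.291, (144) p.300, (161)-(163) p.303; Balaban1984PropagatorsII, (2.1)-(2.2) p.224, Cor. 2.8 (2.151) p.249, Lemma 2.1 (2.61) p.234] -/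
theorem curlCurlPairing_cubeSeqMT3 (ℓ : ℕ) (hL : Odd (ℓ + 1) ∧ 1 < ℓ + 1) (hℓ : 4 ≤ ℓ) :
    ∃ (Mh₀ R₀ : ℕ) (CP : ℝ), 0 ≤ CP ∧
    ∀ (m : ℕ) (hm : 1 ≤ m) (n K : ℕ) (_ : 1 ≤ K - n) (_ : K - n + 1 ≤ m + K) {Mh R a' : ℕ} (_ : Mh = (ℓ + 1) ^ a') (_ : Mh₀ ≤ Mh) (_ : R₀ ≤ R)
      (_ : a' + 3 ≤ m + n) (x₀ : Site (((⟨ℓ + 1, hL, m, hm⟩ : T3Family)).P K) 0) (ρ S : ℕ) (hM : 1 ≤ (ℓ + 1) * Mh) (_ : R * ((ℓ + 1) * Mh) ≤ S)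
      (w : ℕ → PBond (PV 2 ℓ m K hd3 hL) 0 → ℝ)
      (_ : IsLevWeight (⟨ℓ + 1, hL, m, hm⟩ : T3Family) n K (cubeSeqMT3 (⟨ℓ + 1, hL, m, hm⟩ : T3Family) n K x₀ ρ S ((ℓ + 1) * Mh) hM) w)
      (Z : PBond (PV 2 ℓ m K hd3 hL) 0 → ℝ) (s : ℝ) (_ : 0 ≤ s)
      (_ : ∀ (b : PBond (PV 2 ℓ m K hd3 hL) 0) (ν : Fin (2 + 1)),
        w 2 b * (((ℓ + 1 : ℕ) : ℝ)) ^ (K - n) * |Z ⟨b.src.shift ν, b.dir⟩ - Z b| ≤ s)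
      (X : BondIdx (cubeSeqMT3 (⟨ℓ + 1, hL, m, hm⟩ : T3Family) n K x₀ ρ S ((ℓ + 1) * Mh) hM) → ℝ),
        |∑ b : PBond (PV 2 ℓ m K hd3 hL) 0, (dcsE ((((ℓ + 1 : ℕ) : ℝ)) ^ (K - n)) (dcE ((((ℓ + 1 : ℕ) : ℝ)) ^ (K - n))
            (WithLp.toLp 2 (flatH (⟨ℓ + 1, hL, m, hm⟩ : T3Family) n K (cubeSeqMT3 (⟨ℓ + 1, hL, m, hm⟩ : T3Family) n K x₀ ρ S ((ℓ + 1) * Mh) hM) X)))) b * Z b| ≤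
          CP * ((((ℓ + 1 : ℕ) : ℝ)) ^ (K - n)) ^ 3 * s * ∑ c, |X c| := by
  obtain ⟨Mh₀, R₀, CP, hCP, hmain⟩ := FlatPortCurlCurlPairingL0.curlCurlPairing_of_adm22 ℓ hL hℓ
  refine ⟨Mh₀, R₀, CP, hCP, ?_⟩
  intro m hm n K hk1 hk' Mh R a' hMha hMh hR hsize x₀ ρ S hM hRS w hw Z s hs hZ X
  exact hmain m hm n K hk1 hk' hMha hMh hR hsize (cubeSeqMT3 (⟨ℓ + 1, hL, m, hm⟩ : T3Family) n K x₀ ρ S ((ℓ + 1) * Mh) hM)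
    (cubeSeqMT3_k (⟨ℓ + 1, hL, m, hm⟩ : T3Family) n K x₀ ρ S ((ℓ + 1) * Mh) hM)
    (adm22_cubeSeqMT3 (⟨ℓ + 1, hL, m, hm⟩ : T3Family) n K x₀ ρ hM hRS) w hw Z s hs hZ X

/-- ★★ **THE M2 KNIT's `hX1` AT THE ALIGNED CUBE SEQUENCE, KERNEL EXTENSION OF `flatH`**: for every `HM` with `HM X b = Σ_c (flatH e_c)(b) • X c` (e.g. the coercion of
`FlatHCurlCurlMatrix.exists_linearMap_kernelExt`'s ℂ-linear map) and M₂-valued `X` with `‖X c‖ ≤ t`: `w 3 b·‖CC(HM X)(b)‖ ≤ C_X·t`, constants from `L` alone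
(`matrix_curlCurlSupRow` ∘ `curlCurlSupRow_cubeSeqMT3`). [cite: Balaban1985Variational, (88) p.291, (157) p.302, (161)-(163) p.303; Balaban1984PropagatorsII, Cor. 2.8 (2.151) p.249] -/
theorem matrix_curlCurlSupRow_cubeSeqMT3 (ℓ : ℕ) (hL : Odd (ℓ + 1) ∧ 1 < ℓ + 1) (hℓ : 4 ≤ ℓ) :
    ∃ (Mh₀ R₀ : ℕ) (CX : ℝ), 0 ≤ CX ∧
    ∀ (m : ℕ) (hm : 1 ≤ m) (n K : ℕ) (_ : 1 ≤ K - n) (_ : K - n + 1 ≤ m + K) {Mh R a' : ℕ} (_ : Mh = (ℓ + 1) ^ a') (_ : Mh₀ ≤ Mh) (_ : R₀ ≤ R)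
      (_ : a' + 3 ≤ m + n) (x₀ : Site (((⟨ℓ + 1, hL, m, hm⟩ : T3Family)).P K) 0) (ρ S : ℕ) (hM : 1 ≤ (ℓ + 1) * Mh) (_ : R * ((ℓ + 1) * Mh) ≤ S)
      (w : ℕ → PBond (PV 2 ℓ m K hd3 hL) 0 → ℝ)
      (_ : IsLevWeight (⟨ℓ + 1, hL, m, hm⟩ : T3Family) n K (cubeSeqMT3 (⟨ℓ + 1, hL, m, hm⟩ : T3Family) n K x₀ ρ S ((ℓ + 1) * Mh) hM) w)
      (HM : (BondIdx (cubeSeqMT3 (⟨ℓ + 1, hL, m, hm⟩ : T3Family) n K x₀ ρ S ((ℓ + 1) * Mh) hM) → Matrix (Fin 2) (Fin 2) ℂ) → (PBond (((⟨ℓ + 1, hL, m, hm⟩ : T3Family)).P K) 0 → Matrix (Fin 2) (Fin 2) ℂ))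
      (_ : ∀ X b, HM X b = ∑ c, flatH (⟨ℓ + 1, hL, m, hm⟩ : T3Family) n K (cubeSeqMT3 (⟨ℓ + 1, hL, m, hm⟩ : T3Family) n K x₀ ρ S ((ℓ + 1) * Mh) hM) (Pi.single c 1) b • X c)
      (X : BondIdx (cubeSeqMT3 (⟨ℓ + 1, hL, m, hm⟩ : T3Family) n K x₀ ρ S ((ℓ + 1) * Mh) hM) → Matrix (Fin 2) (Fin 2) ℂ) (t : ℝ) (_ : 0 ≤ t) (_ : ∀ c, ‖X c‖ ≤ t)
      (b : PBond (((⟨ℓ + 1, hL, m, hm⟩ : T3Family)).P K) 0),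
        w 3 b * ‖((((((((⟨ℓ + 1, hL, m, hm⟩ : T3Family)).L : ℝ)⁻¹) ^ (K - n)) : ℝ) : ℂ) ^ 2)⁻¹ • ∑ p : Plaq (((⟨ℓ + 1, hL, m, hm⟩ : T3Family)).P K) 0,
          ((Pi.single b (1 : ℂ) : PBond (((⟨ℓ + 1, hL, m, hm⟩ : T3Family)).P K) 0 → ℂ) ⟨p.src, p.μ⟩ + (Pi.single b (1 : ℂ) : PBond (((⟨ℓ + 1, hL, m, hm⟩ : T3Family)).P K) 0 → ℂ) ⟨p.src.shift p.μ, p.ν⟩ -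
              (Pi.single b (1 : ℂ) : PBond (((⟨ℓ + 1, hL, m, hm⟩ : T3Family)).P K) 0 → ℂ) ⟨p.src.shift p.ν, p.μ⟩ - (Pi.single b (1 : ℂ) : PBond (((⟨ℓ + 1, hL, m, hm⟩ : T3Family)).P K) 0 → ℂ) ⟨p.src, p.ν⟩) •
            (HM X ⟨p.src, p.μ⟩ + HM X ⟨p.src.shift p.μ, p.ν⟩ - HM X ⟨p.src.shift p.ν, p.μ⟩ - HM X ⟨p.src, p.ν⟩)‖ ≤ CX * t := by
  classical
  obtain ⟨Mh₀, R₀, CX, hCX, hmain⟩ := curlCurlSupRow_cubeSeqMT3 ℓ hL hℓ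
  refine ⟨Mh₀, R₀, CX, hCX, ?_⟩
  intro m hm n K hk1 hk' Mh R a' hMha hMh hR hsize x₀ ρ S hM hRS w hw HM hHM X t ht hX b
  exact matrix_curlCurlSupRow (F := (⟨ℓ + 1, hL, m, hm⟩ : T3Family)) (H := flatH (⟨ℓ + 1, hL, m, hm⟩ : T3Family) n K (cubeSeqMT3 (⟨ℓ + 1, hL, m, hm⟩ : T3Family) n K x₀ ρ S ((ℓ + 1) * Mh) hM)) hCX
    (fun b' => levWeight_pos hw 3 b') (fun Y t' ht' hY b' => hmain m hm n K hk1 hk' hMha hMh hR hsize x₀ ρ S hM hRS w hw Y t' ht' hY b') HM hHM X t ht hX b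

/-- ★★ **THE M2 KNIT's `hCH` AT THE ALIGNED CUBE SEQUENCE, KERNEL EXTENSION OF `flatH`** (index weight `u ≡ 1`, the `η⁻³ = L^{3(K−n)}` in the constant): for every `HM` with
`HM X b = Σ_c (flatH e_c)(b) • X c`, every M₂-valued field `Z` with gradient letter `≤ s` and every `X`: `‖Σ_b tr(CC(HM X)(b)·Z(b))‖ ≤ 2·C_P·(L^{K−n})³·s·Σ_c ‖X c‖`
(`matrix_curlCurlPairing` ∘ `curlCurlPairing_cubeSeqMT3`). [cite: Balaban1985Variational, (88) p.291, (161)-(163) p.303; Balaban1984PropagatorsII, (2.18)-(2.19) p.226, Cor. 2.8 (2.151) p.249] -/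
theorem matrix_curlCurlPairing_cubeSeqMT3 (ℓ : ℕ) (hL : Odd (ℓ + 1) ∧ 1 < ℓ + 1) (hℓ : 4 ≤ ℓ) :
    ∃ (Mh₀ R₀ : ℕ) (CP : ℝ), 0 ≤ CP ∧
    ∀ (m : ℕ) (hm : 1 ≤ m) (n K : ℕ) (_ : 1 ≤ K - n) (_ : K - n + 1 ≤ m + K) {Mh R a' : ℕ} (_ : Mh = (ℓ + 1) ^ a') (_ : Mh₀ ≤ Mh) (_ : R₀ ≤ R)
      (_ : a' + 3 ≤ m + n) (x₀ : Site (((⟨ℓ + 1, hL, m, hm⟩ : T3Family)).P K) 0) (ρ S : ℕ) (hM : 1 ≤ (ℓ + 1) * Mh) (_ : R * ((ℓ + 1) * Mh) ≤ S)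
      (w : ℕ → PBond (PV 2 ℓ m K hd3 hL) 0 → ℝ)
      (_ : IsLevWeight (⟨ℓ + 1, hL, m, hm⟩ : T3Family) n K (cubeSeqMT3 (⟨ℓ + 1, hL, m, hm⟩ : T3Family) n K x₀ ρ S ((ℓ + 1) * Mh) hM) w)
      (HM : (BondIdx (cubeSeqMT3 (⟨ℓ + 1, hL, m, hm⟩ : T3Family) n K x₀ ρ S ((ℓ + 1) * Mh) hM) → Matrix (Fin 2) (Fin 2) ℂ) → (PBond (((⟨ℓ + 1, hL, m, hm⟩ : T3Family)).P K) 0 → Matrix (Fin 2) (Fin 2) ℂ))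
      (_ : ∀ X b, HM X b = ∑ c, flatH (⟨ℓ + 1, hL, m, hm⟩ : T3Family) n K (cubeSeqMT3 (⟨ℓ + 1, hL, m, hm⟩ : T3Family) n K x₀ ρ S ((ℓ + 1) * Mh) hM) (Pi.single c 1) b • X c)
      (Z : PBond (((⟨ℓ + 1, hL, m, hm⟩ : T3Family)).P K) 0 → Matrix (Fin 2) (Fin 2) ℂ) (s : ℝ) (_ : 0 ≤ s)
      (_ : ∀ (b : PBond (((⟨ℓ + 1, hL, m, hm⟩ : T3Family)).P K) 0) (ν : Fin (((⟨ℓ + 1, hL, m, hm⟩ : T3Family)).P K).d),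
        w 2 b * (((⟨ℓ + 1, hL, m, hm⟩ : T3Family)).L : ℝ) ^ (K - n) * ‖Z ⟨b.src.shift ν, b.dir⟩ - Z b‖ ≤ s)
      (X : BondIdx (cubeSeqMT3 (⟨ℓ + 1, hL, m, hm⟩ : T3Family) n K x₀ ρ S ((ℓ + 1) * Mh) hM) → Matrix (Fin 2) (Fin 2) ℂ),
        ‖∑ b : PBond (((⟨ℓ + 1, hL, m, hm⟩ : T3Family)).P K) 0, Matrix.trace ((((((((((⟨ℓ + 1, hL, m, hm⟩ : T3Family)).L : ℝ)⁻¹) ^ (K - n)) : ℝ) : ℂ) ^ 2)⁻¹ • ∑ p : Plaq (((⟨ℓ + 1, hL, m, hm⟩ : T3Family)).P K) 0,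
          ((Pi.single b (1 : ℂ) : PBond (((⟨ℓ + 1, hL, m, hm⟩ : T3Family)).P K) 0 → ℂ) ⟨p.src, p.μ⟩ + (Pi.single b (1 : ℂ) : PBond (((⟨ℓ + 1, hL, m, hm⟩ : T3Family)).P K) 0 → ℂ) ⟨p.src.shift p.μ, p.ν⟩ -
              (Pi.single b (1 : ℂ) : PBond (((⟨ℓ + 1, hL, m, hm⟩ : T3Family)).P K) 0 → ℂ) ⟨p.src.shift p.ν, p.μ⟩ - (Pi.single b (1 : ℂ) : PBond (((⟨ℓ + 1, hL, m, hm⟩ : T3Family)).P K) 0 → ℂ) ⟨p.src, p.ν⟩) •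
            (HM X ⟨p.src, p.μ⟩ + HM X ⟨p.src.shift p.μ, p.ν⟩ - HM X ⟨p.src.shift p.ν, p.μ⟩ - HM X ⟨p.src, p.ν⟩)) * Z b)‖ ≤
          2 * (CP * ((((ℓ + 1 : ℕ) : ℝ)) ^ (K - n)) ^ 3) * s * ∑ c, (fun _ : BondIdx (cubeSeqMT3 (⟨ℓ + 1, hL, m, hm⟩ : T3Family) n K x₀ ρ S ((ℓ + 1) * Mh) hM) => (1 : ℝ)) c * ‖X c‖ := by
  classical
  obtain ⟨Mh₀, R₀, CP, hCP, hmain⟩ := curlCurlPairing_cubeSeqMT3 ℓ hL hℓ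
  refine ⟨Mh₀, R₀, CP, hCP, ?_⟩
  intro m hm n K hk1 hk' Mh R a' hMha hMh hR hsize x₀ ρ S hM hRS w hw HM hHM Z s hs hZ X
  have hB : 0 ≤ CP * ((((ℓ + 1 : ℕ) : ℝ)) ^ (K - n)) ^ 3 := by positivity
  -- the scalar letter at this datum, in the `u ≡ 1` currency of `matrix_curlCurlPairing`
  have h1 : ∀ (Zr : PBond (PV 2 ℓ m K hd3 hL) 0 → ℝ) (s' : ℝ), 0 ≤ s' →
      (∀ (b : PBond (PV 2 ℓ m K hd3 hL) 0) (ν : Fin (2 + 1)),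
        w 2 b * (((ℓ + 1 : ℕ) : ℝ)) ^ (K - n) * |Zr ⟨b.src.shift ν, b.dir⟩ - Zr b| ≤ s') →
      ∀ Y : BondIdx (cubeSeqMT3 (⟨ℓ + 1, hL, m, hm⟩ : T3Family) n K x₀ ρ S ((ℓ + 1) * Mh) hM) → ℝ,
        |∑ b : PBond (PV 2 ℓ m K hd3 hL) 0, (dcsE ((((ℓ + 1 : ℕ) : ℝ)) ^ (K - n)) (dcE ((((ℓ + 1 : ℕ) : ℝ)) ^ (K - n))
            (WithLp.toLp 2 (flatH (⟨ℓ + 1, hL, m, hm⟩ : T3Family) n K (cubeSeqMT3 (⟨ℓ + 1, hL, m, hm⟩ : T3Family) n K x₀ ρ S ((ℓ + 1) * Mh) hM) Y)))) b * Zr b| ≤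
          (CP * ((((ℓ + 1 : ℕ) : ℝ)) ^ (K - n)) ^ 3) * s' * ∑ c, (fun _ : BondIdx (cubeSeqMT3 (⟨ℓ + 1, hL, m, hm⟩ : T3Family) n K x₀ ρ S ((ℓ + 1) * Mh) hM) => (1 : ℝ)) c * |Y c| := by
    intro Zr s' hs' hZr Y
    have h := hmain m hm n K hk1 hk' hMha hMh hR hsize x₀ ρ S hM hRS w hw Zr s' hs' hZr Y
    have e : (∑ c, (fun _ : BondIdx (cubeSeqMT3 (⟨ℓ + 1, hL, m, hm⟩ : T3Family) n K x₀ ρ S ((ℓ + 1) * Mh) hM) => (1 : ℝ)) c * |Y c|) = ∑ c, |Y c| :=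
      Finset.sum_congr rfl fun c _ => one_mul _
    rw [e]
    exact h
  exact matrix_curlCurlPairing (F := (⟨ℓ + 1, hL, m, hm⟩ : T3Family)) (H := flatH (⟨ℓ + 1, hL, m, hm⟩ : T3Family) n K (cubeSeqMT3 (⟨ℓ + 1, hL, m, hm⟩ : T3Family) n K x₀ ρ S ((ℓ + 1) * Mh) hM))
    (u := fun _ => (1 : ℝ)) hB (fun _ => zero_le_one) (fun b' => (levWeight_pos hw 2 b').le) h1 HM hHM Z s hs hZ X

end PairingAndMatrix

end Summit.QuantumFields.YangMills.Theorems.FlatPortCurlCurlCubeSeq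

end
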